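import Summits.BirchSwinnertonDyer.BirchSwinnertonDyer.Theorems.AdditiveKolyvaginRoadRamifiedHabitatPStarTwistSignAnyLevel
import Summits.BirchSwinnertonDyer.BirchSwinnertonDyer.Theorems.AdditiveKolyvaginRoadRamifiedHabitatSignLawStarred
import HarnessLib

/-!
# Route `AdditiveKolyvaginRoad`, crux KS′ `LevelKolyvaginSystemsAdditive` (stmt-BirchSwinnertonDyer-21396), card `ramified-toric-habitat` —
# the RAMIFIED-HABITAT SIGN LAW `w(E)·w(E^{(d_{K′})}) = ±1 ⟺ e ∤ / ∣ p − 1` for `E` with ARBITRARY reduction away from `p`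

Cell `pub/bsd-wall`, width seat `bsd-wall-akr-p2x-w2` g12; `--supports stmt-BirchSwinnertonDyer-21396` (helper). THEOREMS ONLY; no definition,
no named fact, no `sorry`. BSD is not proved by any of this; KS′/KPA′ stay OPEN at `p² ∣ N`.

The w2 g11 series (`…RamifiedHabitatSignLaw`, `…SignLawStarred`, …; index `SIGNLAW-LANDED.md` on the crux item) proves the card's sign law
for `E` SEMISTABLE AWAY FROM `p` (`N = M·p²` with `M` squarefree). The crux's ♯ frames allow further additive primes `q ≠ p`, and its LOW₀ rows
— the twists `E^{(d_K)}` — are additive at every prime of `d_K`; so the restriction matters. It entered only through the Atkin–Lehner-formal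
ratio `w(E)·w(E^{(p*)}) = (M/p)·λ_p(f)λ_p(f')` (g11 part 2 §3: `λ_q = −a_q` at `q ∥ N`) and the Jacobi-symbol bookkeeping `(M/|d'|) = (M/p)`.
Both are now available for EVERY `M` prime to `p`: the former is `rootNumber_mul_rootNumber_pStarTwist_eq_legendreSym_mul_anyLevel`
(`…PStarTwistSignAnyLevel`, via the PROVED Atkin–Li commutation `w_Q(f_χ) = χ(Q)(w_Q f)_χ`, `Literature/…/CuspFormTwistAtkinLehnerCoprimeProofs`),
the latter is §8 below (`M = ∏ q^{v_q(M)}`, both symbols multiplicative). Hence, with g11's LOCAL computations at `p` unchanged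
(`localRootNumber_mul_pStarTwist_padic`, types II/III/IV; `…_of_ge`, types IV*/III*/II*):

* §8 `jacobiSym_natAbs_eq_legendreSym_of_split_anyLevel` — `(M/|d'|) = (M/p)` for ANY `M` all of whose primes split in `ℚ(√d)`, `d = p*·d'`.
* §9 `rootNumber_mul_rootNumber_pStarTwist_of_localData_anyLevel`, `rootNumber_mul_rootNumber_ramifiedTwist_of_localData_anyLevel` —
  g11's `…_of_localData` (part 7) without `Squarefree M`: `w(E)w(E^{(p*)}) = (M/p)·r` and `w(E)w(E^{(d)}) = −(−1/p)·r` from the local data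
  `W_p(E)W_p(E^{(p*)}) = r`.
* §10 `rootNumber_mul_rootNumber_ramifiedTwist_anyLevel_eq_one_of_not_dvd` / `…_eq_neg_one_of_dvd` — THE DICHOTOMY on ALL SIX potentially good
  non-`I₀*` Kodaira types at once (`ord_p Δ_min = a ∈ {2,3,4,8,9,10}`, `e := 12/gcd(a,12) ∈ {6,4,3,3,4,6}`): `+1` if `e ∤ p − 1` (supercuspidal),
  `−1` if `e ∣ p − 1` (ramified principal series), for `d = p*·d'` (`d' ≡ 1 (4)` squarefree, prime to `N`, `d < 0`, every prime of `M` split in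
  `ℚ(√d)`) and `E` of conductor `M·p²` with NO hypothesis on `M` beyond `p ∤ M`.

CONDITIONAL (as the whole series) on the Modularity Theorem (`exists_isNewformOf`) and Kellock–Dokchitser's Rem. 2.2 at `p` for `E` and
`E^{(p*)}` (named fact `atkinLehnerEigenvalueAt_eq_localRootNumberAt`). The field / global-minimal / Serre-defect headline forms follow in
`…RamifiedHabitatSignLawAnyLevelField`.

References: [cite: Rohrlich1993Compositio, Prop. 2(iv)] [cite: KellockDokchitser2023, Rem. 2.2] [cite: MurtyMurty1997, Ch. 6 §1]
[cite: Knapp1993, Thm. 9.27] [cite: ShemanskeWalling1993, Prop. 5.4].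
-/

set_option autoImplicit false
set_option linter.dupNamespace false

noncomputable section

open scoped Classical MatrixGroups

open CongruenceSubgroup IsDedekindDomain IsDedekindDomain.HeightOneSpectrum NumberField Rat.HeightOneSpectrum
  WeierstrassCurve Literature.NumberTheory.EllipticCurves Literature.NumberTheory.EllipticCurves.ModularForms
  IsDiscreteValuationRing

namespace Summit.BirchSwinnertonDyer.BirchSwinnertonDyer.Theorems.AdditiveKoly.RamifiedHabitat

/-! ## §8 `(M/|d'|) = (M/p)` for any `M` all of whose primes split in `ℚ(√(p*·d'))` -/

section Jacobi

open scoped NumberTheorySymbols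

variable {p : ℕ} [Fact p.Prime]

/-- `(M / |d'|) = (M/p)` for ANY `M ≠ 0` all of whose primes split in `ℚ(√d)`, `d = p*·d'` (prime by prime as in g11's
`jacobiSym_natAbs_eq_legendreSym_of_split`, on `M = ∏ q^{v_q(M)}`; `(·/p)` and `(· / |d'|)` are multiplicative). [folklore] -/
theorem jacobiSym_natAbs_eq_legendreSym_of_split_anyLevel (hp2 : p ≠ 2) {d' : ℤ} (hd'4 : d' % 4 = 1) {M : ℕ} (hM0 : M ≠ 0)
    (hodd : ∀ q ∈ M.primeFactors, q ≠ 2 → J((-1 : ℤ) ^ (p / 2) * p * d' | q) = 1)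
    (htwo : 2 ∣ M → ((-1 : ℤ) ^ (p / 2) * p * d') % 8 = 1) :
    J((M : ℤ) | d'.natAbs) = legendreSym p M := by
  let φ : ℤ →* ℤ :=
    { toFun := fun a ↦ jacobiSym a d'.natAbs
      map_one' := jacobiSym.one_left _
      map_mul' := fun a b ↦ jacobiSym.mul_left a b _ }
  have hφ : ∀ a : ℤ, φ a = J(a | d'.natAbs) := fun _ ↦ rfl
  conv_lhs => rw [Nat.prod_primeFactors_pow_factorization hM0, Nat.cast_prod, ← hφ, map_prod]
  conv_rhs => rw [Nat.prod_primeFactors_pow_factorization hM0, Nat.cast_prod, ← legendreSym.hom_apply, map_prod]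
  refine Finset.prod_congr rfl fun q hq ↦ ?_
  rw [Nat.cast_pow, map_pow, map_pow, hφ, legendreSym.hom_apply]
  congr 1
  haveI := Fact.mk (Nat.prime_of_mem_primeFactors hq)
  by_cases hq2 : q = 2
  · subst hq2
    exact jacobiSym_two_natAbs_eq_legendreSym_of_split hp2 hd'4 (htwo (Nat.dvd_of_mem_primeFactors hq))
  · exact jacobiSym_natAbs_eq_legendreSym_of_split_odd hp2 hd'4 hq2 (hodd q hq hq2)

end Jacobi

/-! ## §9 The assembly with the local data at `p` as hypotheses, arbitrary `M` -/

section LocalData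

open scoped NumberTheorySymbols

variable {p : ℕ} [Fact p.Prime]

/-- **`w(E)·w(E^{(p*)}) = (M/p)·r` from the local data at `p`, ANY `M` prime to `p`.** As g11's
`rootNumber_mul_rootNumber_pStarTwist_of_localData` (part 7) but WITHOUT `Squarefree M`: both minimal models at `p` additive and
`W_p(E)·W_p(E^{(p*)}) = r` as hypotheses; `N = M·p²`, `p ≥ 5`, `p ∤ M`. Conditional on the Modularity Theorem and Kellock–Dokchitser's
Rem. 2.2 at `p` for `E`, `E^{(p*)}`. [cite: Knapp1993, Thm. 9.27] [cite: KellockDokchitser2023, Rem. 2.2] [cite: ShemanskeWalling1993, Prop. 5.4] -/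
theorem rootNumber_mul_rootNumber_pStarTwist_of_localData_anyLevel (W : WeierstrassCurve ℚ) [W.IsElliptic]
    (hmod : exists_isNewformOf) (hF1 : W.atkinLehnerEigenvalueAt_eq_localRootNumberAt)
    (hF1' : (W.quadraticTwist (((-1 : ℤ) ^ (p / 2) * p : ℤ) : ℚ)).atkinLehnerEigenvalueAt_eq_localRootNumberAt)
    (hp5 : 5 ≤ p) {M : ℕ} (hN : W.conductorNorm ℤ = M * p ^ 2) (hpM : ¬ p ∣ M)
    (hadd : ((W.baseChange ℚ_[p]).minimal ℤ_[p]).HasAdditiveReduction ℤ_[p])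
    (hadd' : (((W.quadraticTwist (((-1 : ℤ) ^ (p / 2) * p : ℤ) : ℚ)).baseChange ℚ_[p]).minimal
      ℤ_[p]).HasAdditiveReduction ℤ_[p]) {r : ℤ}
    (hprod : (W.baseChange ℚ_[p]).localRootNumber ℤ_[p] *
      ((W.quadraticTwist (((-1 : ℤ) ^ (p / 2) * p : ℤ) : ℚ)).baseChange ℚ_[p]).localRootNumber ℤ_[p] = r) :
    W.rootNumber * (W.quadraticTwist (((-1 : ℤ) ^ (p / 2) * p : ℤ) : ℚ)).rootNumber = legendreSym p M * r := by
  have hp : p.Prime := Fact.out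
  have hp2 : p ≠ 2 := by omega
  have hdZ0 : ((-1 : ℤ) ^ (p / 2) * p : ℤ) ≠ 0 :=
    mul_ne_zero (pow_ne_zero _ (by norm_num)) (by exact_mod_cast hp.ne_zero)
  have hd0 : (((((-1 : ℤ) ^ (p / 2) * p : ℤ)) : ℚ)) ≠ 0 := by exact_mod_cast hdZ0
  haveI hE' : (W.quadraticTwist (((-1 : ℤ) ^ (p / 2) * p : ℤ) : ℚ)).IsElliptic := W.isElliptic_quadraticTwist hd0
  haveI : NeZero (W.conductorNorm ℤ) := ⟨(W.conductorNorm_pos_holds).ne'⟩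
  haveI : NeZero ((W.quadraticTwist (((-1 : ℤ) ^ (p / 2) * p : ℤ) : ℚ)).conductorNorm ℤ) :=
    ⟨((W.quadraticTwist _).conductorNorm_pos_holds).ne'⟩
  have hN' : (W.quadraticTwist (((-1 : ℤ) ^ (p / 2) * p : ℤ) : ℚ)).conductorNorm ℤ = M * p ^ 2 :=
    (conductorNorm_pStarTwist_eq W hp5 hadd hadd').trans hN
  obtain ⟨f, hf⟩ := hmod W
  obtain ⟨f', hf'⟩ := hmod (W.quadraticTwist (((-1 : ℤ) ^ (p / 2) * p : ℤ) : ℚ))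
  have h0 := rootNumber_mul_rootNumber_pStarTwist_eq_legendreSym_mul_anyLevel W hp2 hN hpM hN' hf hf'
  set P : Nat.Primes := ⟨p, hp⟩ with hP
  have hgen : natGenerator ((primesEquiv (R := ℤ)).symm P) = p :=
    congrArg (fun q : Nat.Primes ↦ (q : ℕ)) ((primesEquiv (R := ℤ)).apply_symm_apply P)
  have h23 : ∀ V : WeierstrassCurve ℚ, V.HasAdditiveReductionAt ((primesEquiv (R := ℤ)).symm P) →
      3 < ringChar (ℤ ⧸ ((primesEquiv (R := ℤ)).symm P).asIdeal) := fun _ _ ↦ by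
    rw [Rat.ringChar_int_quotient_asIdeal, hgen]; omega
  have hPN : (P : ℕ) ∣ W.conductorNorm ℤ := by
    change p ∣ _; rw [hN]; exact ⟨M * p, by ring⟩
  have hPN' : (P : ℕ) ∣ (W.quadraticTwist (((-1 : ℤ) ^ (p / 2) * p : ℤ) : ℚ)).conductorNorm ℤ := by
    change p ∣ _; rw [hN']; exact ⟨M * p, by ring⟩
  have hl : atkinLehnerEigenvalueAt f p = ((W.baseChange ℚ_[p]).localRootNumber ℤ_[p] : ℂ) := by
    rw [← localRootNumberAt_primesEquiv_symm_holds W P]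
    exact hF1 hf P hPN (h23 W)
  have hl' : atkinLehnerEigenvalueAt f' p =
      (((W.quadraticTwist (((-1 : ℤ) ^ (p / 2) * p : ℤ) : ℚ)).baseChange ℚ_[p]).localRootNumber ℤ_[p] : ℂ) := by
    rw [← localRootNumberAt_primesEquiv_symm_holds _ P]
    exact hF1' hf' P hPN' (h23 _)
  rw [hl, hl', ← Int.cast_mul, hprod] at h0
  exact_mod_cast h0

/-- **`w(E)·w(E^{(d)}) = −(−1/p)·r` from the local data at `p`, ANY `M` prime to `p`** (`d = p*·d'` with `d' ≡ 1 (4)` squarefree, prime to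
`N`, `d < 0`, every prime of `M` split in `ℚ(√d)`): g11's `rootNumber_mul_rootNumber_ramifiedTwist_of_localData` (part 7) WITHOUT
`Squarefree M` — the tree form of `w(E)w(E^{(d_{K′})}) = −(−1/p)·w_p(E)·w_p(E^{(d_{K′})})` for a curve with arbitrary reduction off `p`.
Mechanism: `E^{(d)} = (E^{(p*)})^{(d')}`, the coprime twist law `w = (−1/|d'|)(N/|d'|)·w(E^{(p*)})` (Murty–Murty Ch. 6 §1), the previous
theorem, §8 and `(M/p)² = 1`. Conditional on {hmod, F1 at `p`}. [cite: MurtyMurty1997, Ch. 6 §1] [cite: KellockDokchitser2023, Rem. 2.2] -/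
theorem rootNumber_mul_rootNumber_ramifiedTwist_of_localData_anyLevel (W : WeierstrassCurve ℚ) [W.IsElliptic]
    (hmod : exists_isNewformOf) (hF1 : W.atkinLehnerEigenvalueAt_eq_localRootNumberAt)
    (hF1' : (W.quadraticTwist (((-1 : ℤ) ^ (p / 2) * p : ℤ) : ℚ)).atkinLehnerEigenvalueAt_eq_localRootNumberAt)
    (hp5 : 5 ≤ p) {M : ℕ} (hN : W.conductorNorm ℤ = M * p ^ 2) (hpM : ¬ p ∣ M)
    (hadd : ((W.baseChange ℚ_[p]).minimal ℤ_[p]).HasAdditiveReduction ℤ_[p])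
    (hadd' : (((W.quadraticTwist (((-1 : ℤ) ^ (p / 2) * p : ℤ) : ℚ)).baseChange ℚ_[p]).minimal
      ℤ_[p]).HasAdditiveReduction ℤ_[p]) {r : ℤ}
    (hprod : (W.baseChange ℚ_[p]).localRootNumber ℤ_[p] *
      ((W.quadraticTwist (((-1 : ℤ) ^ (p / 2) * p : ℤ) : ℚ)).baseChange ℚ_[p]).localRootNumber ℤ_[p] = r)
    {d' : ℤ} (hd'4 : d' % 4 = 1) (hd'sq : Squarefree d') (hgcd : Int.gcd d' (W.conductorNorm ℤ) = 1)
    (hneg : (-1 : ℤ) ^ (p / 2) * p * d' < 0)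
    (hodd : ∀ q ∈ M.primeFactors, q ≠ 2 → J((-1 : ℤ) ^ (p / 2) * p * d' | q) = 1)
    (htwo : 2 ∣ M → ((-1 : ℤ) ^ (p / 2) * p * d') % 8 = 1) :
    W.rootNumber * (W.quadraticTwist (((-1 : ℤ) ^ (p / 2) * p * d' : ℤ) : ℚ)).rootNumber = -ZMod.χ₄ p * r := by
  have hp : p.Prime := Fact.out
  have hp2 : p ≠ 2 := by omega
  have hdZ0 : ((-1 : ℤ) ^ (p / 2) * p : ℤ) ≠ 0 :=
    mul_ne_zero (pow_ne_zero _ (by norm_num)) (by exact_mod_cast hp.ne_zero)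
  have hd0 : (((((-1 : ℤ) ^ (p / 2) * p : ℤ)) : ℚ)) ≠ 0 := by exact_mod_cast hdZ0
  haveI hE' : (W.quadraticTwist (((-1 : ℤ) ^ (p / 2) * p : ℤ) : ℚ)).IsElliptic := W.isElliptic_quadraticTwist hd0
  have hM0 : M ≠ 0 := by
    intro h; rw [h, zero_mul] at hN; exact (W.conductorNorm_pos_holds).ne' hN
  have hA := rootNumber_mul_rootNumber_pStarTwist_of_localData_anyLevel W hmod hF1 hF1' hp5 hN hpM hadd hadd' hprod
  have hN' : (W.quadraticTwist (((-1 : ℤ) ^ (p / 2) * p : ℤ) : ℚ)).conductorNorm ℤ = M * p ^ 2 :=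
    (conductorNorm_pStarTwist_eq W hp5 hadd hadd').trans hN
  have hgcd' : Int.gcd d' ((W.quadraticTwist (((-1 : ℤ) ^ (p / 2) * p : ℤ) : ℚ)).conductorNorm ℤ) = 1 := by
    rw [hN', ← hN]; exact hgcd
  have hB := ((W.quadraticTwist (((-1 : ℤ) ^ (p / 2) * p : ℤ) : ℚ)).rootNumber_quadraticTwist_of_emod_four_eq_one
    hmod hd'4 hd'sq hgcd').1
  rw [quadraticTwist_quadraticTwist, hN'] at hB
  have hcast : ((((-1 : ℤ) ^ (p / 2) * p : ℤ) : ℚ)) * (d' : ℚ) = (((-1 : ℤ) ^ (p / 2) * p * d' : ℤ) : ℚ) := by push_cast; ring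
  rw [hcast] at hB
  have hNe0 : NeZero d'.natAbs := ⟨Int.natAbs_ne_zero.mpr (by rintro rfl; norm_num at hd'4)⟩
  have hJM : J(((M * p ^ 2 : ℕ) : ℤ) | d'.natAbs) = legendreSym p M := by
    rw [Nat.cast_mul, jacobiSym.mul_left, jacobiSym_natAbs_eq_legendreSym_of_split_anyLevel hp2 hd'4 hM0 hodd htwo, Nat.cast_pow,
      jacobiSym.sq_one', mul_one]
    rw [Int.gcd_natCast_natCast]
    have h1 : Nat.Coprime d'.natAbs (W.conductorNorm ℤ) := by
      have := hgcd; unfold Int.gcd at this; simpa using this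
    have hpN : p ∣ W.conductorNorm ℤ := by rw [hN]; exact ⟨M * p, by ring⟩
    exact (Nat.Coprime.coprime_dvd_right hpN h1).symm
  have hJ1 := jacobiSym_neg_one_natAbs_eq_of_neg hp2 hd'4 hneg
  have hM2 : legendreSym p M * legendreSym p M = 1 := by
    rw [← sq]
    refine legendreSym.sq_one p ?_
    rw [Int.cast_natCast, ne_eq, ZMod.natCast_eq_zero_iff]
    exact hpM
  calc W.rootNumber * (W.quadraticTwist (((-1 : ℤ) ^ (p / 2) * p * d' : ℤ) : ℚ)).rootNumber
      = J(-1 | d'.natAbs) * J(((M * p ^ 2 : ℕ) : ℤ) | d'.natAbs) *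
          (W.rootNumber * (W.quadraticTwist (((-1 : ℤ) ^ (p / 2) * p : ℤ) : ℚ)).rootNumber) := by rw [hB]; ring
    _ = -ZMod.χ₄ p * legendreSym p M * (legendreSym p M * r) := by rw [hJ1, hJM, hA]
    _ = -ZMod.χ₄ p * r := by linear_combination (-(ZMod.χ₄ ↑p) * r) * hM2

end LocalData

/-! ## §10 The dichotomy on all six potentially good non-`I₀*` types, arbitrary `M` -/

section Dichotomy

open scoped NumberTheorySymbols

variable {p : ℕ} [Fact p.Prime]

/-- `χ₄(p)² = 1` for odd `p`. [folklore] -/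
theorem χ₄_mul_self_of_ne_two (hp2 : p ≠ 2) : ZMod.χ₄ p * ZMod.χ₄ p = 1 := by
  have hp' := (Nat.Prime.eq_two_or_odd (Fact.out : p.Prime)).resolve_left hp2
  rw [ZMod.χ₄_nat_eq_if_mod_four]
  have : p % 4 = 1 ∨ p % 4 = 3 := by omega
  have h2' : p % 2 ≠ 0 := by omega
  rcases this with h | h <;> simp [h, h2']

/-- **THE RAMIFIED-HABITAT SIGN RATIO on the six potentially good non-`I₀*` types, ANY `M` prime to `p`.** `W/ℚ` elliptic of conductor
`N = M·p²` (`p ≥ 5`, `p ∤ M`; NO further hypothesis on `M`), minimal model at `p` with `ord_p Δ = a ∈ {2,3,4,8,9,10}`, `ord_p c₄ > 0`,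
`3 ord_p c₄ ≥ ord_p Δ` (Kodaira II, III, IV, IV*, III*, II*; `e := 12/gcd(a,12) = 6,4,3,3,4,6`); `d = p*·d'` with `d' ≡ 1 (4)` squarefree, prime
to `N`, `d < 0`, every prime of `M` split in `ℚ(√d)`. Then `w(W)·w(W^{(d)}) = −(−1/p)` if `e = 4` (`a ∈ {3, 9}`) and `= −(−3/p)` if
`e ∈ {3, 6}`. ASSUMING the Modularity Theorem and Kellock–Dokchitser's Rem. 2.2 at `p` for `W`, `W^{(p*)}`.
[cite: Rohrlich1993Compositio, Prop. 2(iv)] [cite: KellockDokchitser2023, Rem. 2.2] [cite: MurtyMurty1997, Ch. 6 §1] -/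
theorem rootNumber_mul_rootNumber_ramifiedTwist_anyLevel (W : WeierstrassCurve ℚ) [W.IsElliptic] (hmod : exists_isNewformOf)
    (hF1 : W.atkinLehnerEigenvalueAt_eq_localRootNumberAt)
    (hF1' : (W.quadraticTwist (((-1 : ℤ) ^ (p / 2) * p : ℤ) : ℚ)).atkinLehnerEigenvalueAt_eq_localRootNumberAt)
    (hp5 : 5 ≤ p) {M : ℕ} (hN : W.conductorNorm ℤ = M * p ^ 2) (hpM : ¬ p ∣ M) {a : ℕ}
    (hΔ : addVal ℤ_[p] (((W.baseChange ℚ_[p]).minimal ℤ_[p]).integralModel ℤ_[p]).Δ = a)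
    (ha : a = 2 ∨ a = 3 ∨ a = 4 ∨ a = 8 ∨ a = 9 ∨ a = 10)
    (hc₄ : addVal ℤ_[p] (((W.baseChange ℚ_[p]).minimal ℤ_[p]).integralModel ℤ_[p]).c₄ ≠ 0)
    (hj : ¬ 3 * addVal ℤ_[p] (((W.baseChange ℚ_[p]).minimal ℤ_[p]).integralModel ℤ_[p]).c₄ <
      addVal ℤ_[p] (((W.baseChange ℚ_[p]).minimal ℤ_[p]).integralModel ℤ_[p]).Δ)
    {d' : ℤ} (hd'4 : d' % 4 = 1) (hd'sq : Squarefree d') (hgcd : Int.gcd d' (W.conductorNorm ℤ) = 1)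
    (hneg : (-1 : ℤ) ^ (p / 2) * p * d' < 0)
    (hodd : ∀ q ∈ M.primeFactors, q ≠ 2 → J((-1 : ℤ) ^ (p / 2) * p * d' | q) = 1)
    (htwo : 2 ∣ M → ((-1 : ℤ) ^ (p / 2) * p * d') % 8 = 1) :
    W.rootNumber * (W.quadraticTwist (((-1 : ℤ) ^ (p / 2) * p * d' : ℤ) : ℚ)).rootNumber =
      if a = 3 ∨ a = 9 then -ZMod.χ₄ p else -(if p % 3 = 1 then 1 else -1) := by
  have hp2 : p ≠ 2 := by omega
  have hχ₄ := χ₄_mul_self_of_ne_two (p := p) hp2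
  rcases (show (a = 2 ∨ a = 3 ∨ a = 4) ∨ (a = 8 ∨ a = 9 ∨ a = 10) by omega) with h | h
  · obtain ⟨hadd, hadd', hprod⟩ := localRootNumber_mul_pStarTwist_padic W hp5 hΔ h hc₄ hj
    rw [rootNumber_mul_rootNumber_ramifiedTwist_of_localData_anyLevel W hmod hF1 hF1' hp5 hN hpM hadd hadd' hprod hd'4 hd'sq hgcd
      hneg hodd htwo]
    rcases h with rfl | rfl | rfl
    · rw [if_neg (show ¬ ((2 : ℕ) = 3) by omega), if_neg (show ¬ ((2 : ℕ) = 3 ∨ (2 : ℕ) = 9) by omega)]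
      split_ifs
      · linear_combination -hχ₄
      · linear_combination hχ₄
    · simp
    · rw [if_neg (show ¬ ((4 : ℕ) = 3) by omega), if_neg (show ¬ ((4 : ℕ) = 3 ∨ (4 : ℕ) = 9) by omega)]
      split_ifs
      · linear_combination -hχ₄
      · linear_combination hχ₄
  · obtain ⟨hadd, hadd', hprod⟩ := localRootNumber_mul_pStarTwist_padic_of_ge W hp5 hΔ h hc₄ hj
    rw [rootNumber_mul_rootNumber_ramifiedTwist_of_localData_anyLevel W hmod hF1 hF1' hp5 hN hpM hadd hadd' hprod hd'4 hd'sq hgcd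
      hneg hodd htwo]
    rcases h with rfl | rfl | rfl
    · rw [if_neg (show ¬ ((8 : ℕ) = 9) by omega), if_neg (show ¬ ((8 : ℕ) = 3 ∨ (8 : ℕ) = 9) by omega)]
      split_ifs
      · linear_combination -hχ₄
      · linear_combination hχ₄
    · simp
    · rw [if_neg (show ¬ ((10 : ℕ) = 9) by omega), if_neg (show ¬ ((10 : ℕ) = 3 ∨ (10 : ℕ) = 9) by omega)]
      split_ifs
      · linear_combination -hχ₄
      · linear_combination hχ₄

/-- **SUPERCUSPIDAL HALF, ANY `M` (`e ∤ p − 1 ⟹ w(E)·w(E^{(d)}) = +1`)** on the six types at once (`e := 12/gcd(a,12)`, `a ∈ {2,3,4,8,9,10}`),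
for `E` with ARBITRARY reduction at the primes `q ≠ p`: the card's `SignLawSupercuspidal` for odd `d`, in the `p`-adic currency, conditional
on {hmod, F1 at `p`}. (`e = 4 ∤ p−1 ⟺ p ≡ 3 (4) ⟺ (−1/p) = −1`; `e ∈ {3,6}`, `e ∤ p−1 ⟺ p ≡ 2 (3) ⟺ (−3/p) = −1`.)
[cite: Rohrlich1993Compositio, Prop. 2(iv)] [cite: KellockDokchitser2023, Rem. 2.2] -/
theorem rootNumber_mul_rootNumber_ramifiedTwist_anyLevel_eq_one_of_not_dvd (W : WeierstrassCurve ℚ) [W.IsElliptic]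
    (hmod : exists_isNewformOf) (hF1 : W.atkinLehnerEigenvalueAt_eq_localRootNumberAt)
    (hF1' : (W.quadraticTwist (((-1 : ℤ) ^ (p / 2) * p : ℤ) : ℚ)).atkinLehnerEigenvalueAt_eq_localRootNumberAt)
    (hp5 : 5 ≤ p) {M : ℕ} (hN : W.conductorNorm ℤ = M * p ^ 2) (hpM : ¬ p ∣ M) {a : ℕ}
    (hΔ : addVal ℤ_[p] (((W.baseChange ℚ_[p]).minimal ℤ_[p]).integralModel ℤ_[p]).Δ = a)
    (ha : a = 2 ∨ a = 3 ∨ a = 4 ∨ a = 8 ∨ a = 9 ∨ a = 10)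
    (hc₄ : addVal ℤ_[p] (((W.baseChange ℚ_[p]).minimal ℤ_[p]).integralModel ℤ_[p]).c₄ ≠ 0)
    (hj : ¬ 3 * addVal ℤ_[p] (((W.baseChange ℚ_[p]).minimal ℤ_[p]).integralModel ℤ_[p]).c₄ <
      addVal ℤ_[p] (((W.baseChange ℚ_[p]).minimal ℤ_[p]).integralModel ℤ_[p]).Δ)
    {d' : ℤ} (hd'4 : d' % 4 = 1) (hd'sq : Squarefree d') (hgcd : Int.gcd d' (W.conductorNorm ℤ) = 1)
    (hneg : (-1 : ℤ) ^ (p / 2) * p * d' < 0)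
    (hodd : ∀ q ∈ M.primeFactors, q ≠ 2 → J((-1 : ℤ) ^ (p / 2) * p * d' | q) = 1)
    (htwo : 2 ∣ M → ((-1 : ℤ) ^ (p / 2) * p * d') % 8 = 1)
    (hsc : ¬ 12 / Nat.gcd a 12 ∣ p - 1) :
    W.rootNumber * (W.quadraticTwist (((-1 : ℤ) ^ (p / 2) * p * d' : ℤ) : ℚ)).rootNumber = 1 := by
  rw [rootNumber_mul_rootNumber_ramifiedTwist_anyLevel W hmod hF1 hF1' hp5 hN hpM hΔ ha hc₄ hj hd'4 hd'sq hgcd hneg hodd htwo]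
  have hp' := (Nat.Prime.eq_two_or_odd (Fact.out : p.Prime)).resolve_left (by omega)
  rcases ha with rfl | rfl | rfl | rfl | rfl | rfl
  · have e6 : 12 / Nat.gcd 2 12 = 6 := by decide
    rw [e6] at hsc
    have h3 : p % 3 ≠ 1 := fun h ↦ hsc (by omega)
    simp [h3]
  · have e4 : 12 / Nat.gcd 3 12 = 4 := by decide
    rw [e4] at hsc
    have h4 : p % 4 = 3 := by omega
    simp [ZMod.χ₄_nat_three_mod_four h4]
  · have e3 : 12 / Nat.gcd 4 12 = 3 := by decide
    rw [e3] at hsc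
    have h3 : p % 3 ≠ 1 := fun h ↦ hsc (by omega)
    simp [h3]
  · have e3 : 12 / Nat.gcd 8 12 = 3 := by decide
    rw [e3] at hsc
    have h3 : p % 3 ≠ 1 := fun h ↦ hsc (by omega)
    simp [h3]
  · have e4 : 12 / Nat.gcd 9 12 = 4 := by decide
    rw [e4] at hsc
    have h4 : p % 4 = 3 := by omega
    simp [ZMod.χ₄_nat_three_mod_four h4]
  · have e6 : 12 / Nat.gcd 10 12 = 6 := by decide
    rw [e6] at hsc
    have h3 : p % 3 ≠ 1 := fun h ↦ hsc (by omega)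
    simp [h3]

/-- **PRINCIPAL-SERIES HALF, ANY `M` (`e ∣ p − 1 ⟹ w(E)·w(E^{(d)}) = −1`)**, same data (POTENTIALLY GOOD; on the potentially multiplicative rows
the sign depends on `d`, evidence #41 on the crux item). Conditional on {hmod, F1 at `p`}.
[cite: Rohrlich1993Compositio, Prop. 2(iv)] [cite: KellockDokchitser2023, Rem. 2.2] -/
theorem rootNumber_mul_rootNumber_ramifiedTwist_anyLevel_eq_neg_one_of_dvd (W : WeierstrassCurve ℚ) [W.IsElliptic]
    (hmod : exists_isNewformOf) (hF1 : W.atkinLehnerEigenvalueAt_eq_localRootNumberAt)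
    (hF1' : (W.quadraticTwist (((-1 : ℤ) ^ (p / 2) * p : ℤ) : ℚ)).atkinLehnerEigenvalueAt_eq_localRootNumberAt)
    (hp5 : 5 ≤ p) {M : ℕ} (hN : W.conductorNorm ℤ = M * p ^ 2) (hpM : ¬ p ∣ M) {a : ℕ}
    (hΔ : addVal ℤ_[p] (((W.baseChange ℚ_[p]).minimal ℤ_[p]).integralModel ℤ_[p]).Δ = a)
    (ha : a = 2 ∨ a = 3 ∨ a = 4 ∨ a = 8 ∨ a = 9 ∨ a = 10)
    (hc₄ : addVal ℤ_[p] (((W.baseChange ℚ_[p]).minimal ℤ_[p]).integralModel ℤ_[p]).c₄ ≠ 0)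
    (hj : ¬ 3 * addVal ℤ_[p] (((W.baseChange ℚ_[p]).minimal ℤ_[p]).integralModel ℤ_[p]).c₄ <
      addVal ℤ_[p] (((W.baseChange ℚ_[p]).minimal ℤ_[p]).integralModel ℤ_[p]).Δ)
    {d' : ℤ} (hd'4 : d' % 4 = 1) (hd'sq : Squarefree d') (hgcd : Int.gcd d' (W.conductorNorm ℤ) = 1)
    (hneg : (-1 : ℤ) ^ (p / 2) * p * d' < 0)
    (hodd : ∀ q ∈ M.primeFactors, q ≠ 2 → J((-1 : ℤ) ^ (p / 2) * p * d' | q) = 1)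
    (htwo : 2 ∣ M → ((-1 : ℤ) ^ (p / 2) * p * d') % 8 = 1)
    (hps : 12 / Nat.gcd a 12 ∣ p - 1) :
    W.rootNumber * (W.quadraticTwist (((-1 : ℤ) ^ (p / 2) * p * d' : ℤ) : ℚ)).rootNumber = -1 := by
  rw [rootNumber_mul_rootNumber_ramifiedTwist_anyLevel W hmod hF1 hF1' hp5 hN hpM hΔ ha hc₄ hj hd'4 hd'sq hgcd hneg hodd htwo]
  have hp' := (Nat.Prime.eq_two_or_odd (Fact.out : p.Prime)).resolve_left (by omega)
  rcases ha with rfl | rfl | rfl | rfl | rfl | rfl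
  · have e6 : 12 / Nat.gcd 2 12 = 6 := by decide
    rw [e6] at hps
    have h3 : p % 3 = 1 := by omega
    simp [h3]
  · have e4 : 12 / Nat.gcd 3 12 = 4 := by decide
    rw [e4] at hps
    have h4 : p % 4 = 1 := by omega
    simp [ZMod.χ₄_nat_one_mod_four h4]
  · have e3 : 12 / Nat.gcd 4 12 = 3 := by decide
    rw [e3] at hps
    have h3 : p % 3 = 1 := by omega
    simp [h3]
  · have e3 : 12 / Nat.gcd 8 12 = 3 := by decide
    rw [e3] at hps
    have h3 : p % 3 = 1 := by omega
    simp [h3]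
  · have e4 : 12 / Nat.gcd 9 12 = 4 := by decide
    rw [e4] at hps
    have h4 : p % 4 = 1 := by omega
    simp [ZMod.χ₄_nat_one_mod_four h4]
  · have e6 : 12 / Nat.gcd 10 12 = 6 := by decide
    rw [e6] at hps
    have h3 : p % 3 = 1 := by omega
    simp [h3]

end Dichotomy

end Summit.BirchSwinnertonDyer.BirchSwinnertonDyer.Theorems.AdditiveKoly.RamifiedHabitat

end
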